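import Mathlib
import HarnessLib
import Literature.Analysis.FluidPDE.SuitableWeak
import Literature.Analysis.FluidPDE.SelfSimilar
import Literature.Analysis.FluidPDE.LocalTypeI
import Literature.Analysis.FluidPDE.ESSLocalHolderNoConcentration
import Summits.NavierStokesRegularity.NavierStokesRegularity.Theorems.RellichScarNoMildScar
import Summits.NavierStokesRegularity.NavierStokesRegularity.Theorems.RellichScarApexLocalisationHalfspaceStripLiouville
import Summits.NavierStokesRegularity.NavierStokesRegularity.Theorems.RellichScarApexLocalisationHalfspaceFarFieldCurlOfTopCurl

/-!
# Route `RellichScar`, crux `ApexLocalisation` (stmt-NavierStokesRegularity-11719) support — and KIT parts 2–3 of the STAGED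
# door S15 `LocalIrrotationalScarDoor` (nsreg-p1 ROUND-14): NO SINGULAR APEX WITH AN IRROTATIONAL HALF-SPACE SCAR

* `halfspaceFarFieldRepresentative_noTop` (S3′) — the tree's `stub_halfspaceFarFieldRepresentative` minus its `hsmall`
  input and its two cut-off/weak-top conclusions: the smooth far-field representative on a half-space needs only
  `|w| ≤ 1` there and `𝐈 < ⊤` (ESS 2003 §3 (3.26)–(3.30));
* `not_isBackwardSingularPoint_of_topCurlVanishing_halfspace` (K2R) — an apex Type-I profile (`‖w(t,x)‖ ≤
  C/(‖x‖+√(−t))` a.e.) admitting a continuous representative with `C¹` slices on `]-1,0[ × {⟪x,e⟫ > 0}` whose CURL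
  tends to zero at the top locally uniformly near every point of the half-space is NOT singular at the origin:
  S3′ → transfer of the top-curl hypothesis to the smooth representative → S2′ (`…HalfspaceFarFieldCurlOfTopCurl`)
  → S4 (`stub_halfspaceStripLiouville`, tree) → the strips exhaust `]-1/3, 0[` (ESS 2003 Thm 1.4, §3, Thm 5.1).
This IS the residue `IrrotationalHalfspaceScarLiouvilleRep` (K2Rep) of the staged door S15, whose route item will
close by the one-liner `fun _C _e he _w _π _H _Uc hsw hwg hI hapex hUc hUcc htopc =>
not_isBackwardSingularPoint_of_topCurlVanishing_halfspace hsw hwg hI hapex he hUc hUcc htopc` at birth (the decl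
itself is not restated here).

Source: nsreg-p1 g12's kit `HOME/ns-regularity-ideate-p1/r14/IrrotScarKit.lean` (sha16 0fabdd243612eba0), parts 2–3,
landed verbatim by nsreg-p6 g7 (namespace → this Theorems module, notations expanded); helper
`--supports stmt-NavierStokesRegularity-11719`.

WHAT THIS IS NOT: not NS regularity; not the S15 zoom crux `K1Rep` (open); not a route open.
-/

noncomputable section

-- the summit and its single sub-problem share the name (CONVENTIONS §1), as in every Theorems file
set_option linter.dupNamespace false

namespace Summit.NavierStokesRegularity.NavierStokesRegularity.Theorems.RellichScarApexLocalisationIrrotHalfspaceLiouville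
open Summit.NavierStokesRegularity.NavierStokesRegularity.Theorems.RellichScarApexLocalisation
open Summit.NavierStokesRegularity.NavierStokesRegularity.Theorems.RellichScarNoMildScar
open Summit.NavierStokesRegularity.NavierStokesRegularity.Theorems.RellichScarApexLocalisationHalfspaceFarFieldCurlOfTopCurl

open MeasureTheory Set Function Metric Filter Topology TopologicalSpace
open scoped ENNReal NNReal InnerProductSpace RealInnerProductSpace
open Literature.Analysis Literature.Analysis.FluidPDE

/-! ### KIT part 2 — S3′: the far-field representative on a half-space WITHOUT any top hypothesis
(the tree's `stub_halfspaceFarFieldRepresentative` minus its `hsmall` input and its two cut-off/weak-top conclusions;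
the representative itself only needs `|w| ≤ 1` on the far half-space and `𝐈 < ⊤`). -/

/-- Copy of the tree's private `halfspaceFarField_ball_subset` (unit thickening of `{⟪x, e⟫ > R₀ + 1}` lies in
`{⟪x, e⟫ > R₀}`). [folklore] -/
theorem kit_halfspaceFarField_ball_subset {e : (EuclideanSpace ℝ (Fin 3))} (he : ‖e‖ = 1) {R₀ : ℝ} {x : (EuclideanSpace ℝ (Fin 3))}
    (hx : R₀ + 1 < ⟪x, e⟫) : ball x (2 * (1 / 2 : ℝ)) ⊆ {y : (EuclideanSpace ℝ (Fin 3)) | R₀ < ⟪y, e⟫} := by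
  intro y hy
  rw [mem_ball, dist_eq_norm] at hy
  have h1 : |⟪y - x, e⟫| ≤ ‖y - x‖ * ‖e‖ := abs_real_inner_le_norm (y - x) e
  rw [he, mul_one, inner_sub_left, abs_le] at h1
  show R₀ < ⟪y, e⟫
  linarith [h1.1]

/-- **S3′.** [cite: EscauriazaSereginSverak2003, §3 (3.26)-(3.30)] -/
theorem halfspaceFarFieldRepresentative_noTop :
    ∀ (e : (EuclideanSpace ℝ (Fin 3))), ‖e‖ = 1 → ∀ (R₀ : ℝ), 0 < R₀ →
      ∀ (w : ℝ → (EuclideanSpace ℝ (Fin 3)) → (EuclideanSpace ℝ (Fin 3))) (π : ℝ → (EuclideanSpace ℝ (Fin 3)) → ℝ) (H : ℝ → (EuclideanSpace ℝ (Fin 3)) → (EuclideanSpace ℝ (Fin 3)) →L[ℝ] (EuclideanSpace ℝ (Fin 3))),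
      IsSuitableWeakSolutionOn (Literature.Analysis.FluidPDE.slab (EuclideanSpace ℝ (Fin 3)) (Set.Iio (0 : ℝ)) isOpen_Iio) 1 0 w π → HasWeakSpatialGradientOn (Literature.Analysis.FluidPDE.slab (EuclideanSpace ℝ (Fin 3)) (Set.Iio (0 : ℝ)) isOpen_Iio) w H →
      typeIBound (Iio (0 : ℝ) ×ˢ univ) w π H < ⊤ →
      (∀ᵐ z ∂(volume.restrict (Ioo (-2 : ℝ) 0 ×ˢ {x : (EuclideanSpace ℝ (Fin 3)) | R₀ < ⟪x, e⟫})), ‖w z.1 z.2‖ ≤ 1) →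
      ∃ (Uf : ℝ → (EuclideanSpace ℝ (Fin 3)) → (EuclideanSpace ℝ (Fin 3))) (K : ℝ),
        uncurry Uf =ᵐ[volume.restrict (Ioo (-1 : ℝ) 0 ×ˢ {x : (EuclideanSpace ℝ (Fin 3)) | R₀ + 1 < ⟪x, e⟫})] uncurry w ∧
        ContinuousOn (uncurry Uf) (Ioo (-1 : ℝ) 0 ×ˢ {x : (EuclideanSpace ℝ (Fin 3)) | R₀ + 1 < ⟪x, e⟫}) ∧
        IsDistributionalNSSolutionOn ⟨Ioo (-1 : ℝ) 0 ×ˢ {x : (EuclideanSpace ℝ (Fin 3)) | R₀ + 1 < ⟪x, e⟫},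
          isOpen_Ioo.prod (isOpen_lt continuous_const (continuous_id.inner continuous_const))⟩ 1 0 Uf π ∧
        (∀ t ∈ Ioo (-1 : ℝ) 0, ContDiffOn ℝ 4 (Uf t) {x : (EuclideanSpace ℝ (Fin 3)) | R₀ + 1 < ⟪x, e⟫}) ∧
        (∀ n ≤ 4, ContinuousOn (fun z : ℝ × (EuclideanSpace ℝ (Fin 3)) => iteratedFDeriv ℝ n (Uf z.1) z.2)
          (Ioo (-1 : ℝ) 0 ×ˢ {x : (EuclideanSpace ℝ (Fin 3)) | R₀ + 1 < ⟪x, e⟫})) ∧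
        (∀ n ≤ 3, ∀ z ∈ Ioo (-1 : ℝ) 0 ×ˢ {x : (EuclideanSpace ℝ (Fin 3)) | R₀ + 1 < ⟪x, e⟫}, ‖iteratedFDeriv ℝ n (Uf z.1) z.2‖ ≤ K) := by
  intro e he R₀ _hR₀ w π H hsw _hwg hI hfar
  set I : ℝ≥0∞ := typeIBound (Iio (0 : ℝ) ×ˢ (univ : Set (EuclideanSpace ℝ (Fin 3)))) w π H with hIdef
  have hItop : I ≠ ⊤ := hI.ne
  set S : Set (EuclideanSpace ℝ (Fin 3)) := {x : (EuclideanSpace ℝ (Fin 3)) | R₀ + 1 < ⟪x, e⟫} with hS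
  have hSo : IsOpen S := isOpen_lt continuous_const (continuous_id.inner continuous_const)
  -- the thickening condition
  have hSS' : ∀ x ∈ S, ball x (2 * (1 / 2 : ℝ)) ⊆ {y : (EuclideanSpace ℝ (Fin 3)) | R₀ < ⟪y, e⟫} := fun x hx =>
    kit_halfspaceFarField_ball_subset he hx
  -- ## the representative, cylinder by cylinder in the local gauge
  set P : ℝ≥0 := (ENNReal.ofReal (2 * (1 / 2 : ℝ)) ^ 2 * I).toNNReal with hP
  have hPeq : ((P : ℝ≥0) : ℝ≥0∞) = ENNReal.ofReal (2 * (1 / 2 : ℝ)) ^ 2 * I :=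
    ENNReal.coe_toNNReal (ENNReal.mul_ne_top (ENNReal.pow_ne_top ENNReal.ofReal_ne_top) hItop)
  have hloc : ∀ z ∈ Ioo (-1 : ℝ) 0 ×ˢ S, ∃ πz : ℝ → (EuclideanSpace ℝ (Fin 3)) → ℝ,
      IsDistributionalNSSolutionOn
        (parabolicCylinderOpens (2 * (1 / 2 : ℝ)) (min (z.1 + (1 / 2 : ℝ) ^ 2) 0, z.2)) 1 0 w πz ∧
      (∀ᵐ q ∂(volume.restrict (parabolicCylinder (2 * (1 / 2 : ℝ)) (min (z.1 + (1 / 2 : ℝ) ^ 2) 0, z.2))),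
        ‖w q.1 q.2‖ ≤ (1 : ℝ)) ∧
      ∫⁻ q in parabolicCylinder (2 * (1 / 2 : ℝ)) (min (z.1 + (1 / 2 : ℝ) ^ 2) 0, z.2),
        ‖πz q.1 q.2‖ₑ ^ (3 / 2 : ℝ) ≤ P := by
    rintro ⟨t, x⟩ ⟨ht, hx⟩
    set z₀ : ℝ × (EuclideanSpace ℝ (Fin 3)) := (min (t + (1 / 2 : ℝ) ^ 2) 0, x) with hz₀
    have hz₀t : z₀.1 ≤ 0 := min_le_right _ _
    refine ⟨fun s y => π s y - ⨍ y' in ball z₀.2 (2 * (1 / 2 : ℝ)), π s y', ?_, ?_, ?_⟩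
    · exact ((sub_ballMean_slab hsw z₀.2 (by norm_num : (0 : ℝ) < 2 * (1 / 2))).of_le
        (parabolicCylinderOpens_le_slab _ hz₀t)).distributional
    · -- the cylinder lies in the far region
      have hcyl : parabolicCylinder (2 * (1 / 2 : ℝ)) z₀ ⊆
          Ioo (-2 : ℝ) 0 ×ˢ {y : (EuclideanSpace ℝ (Fin 3)) | R₀ < ⟪y, e⟫} := by
        rintro ⟨s, y⟩ hq
        rw [mem_parabolicCylinder] at hq
        obtain ⟨⟨hs1, hs2⟩, hy⟩ := hq
        refine ⟨⟨?_, lt_of_lt_of_le hs2 hz₀t⟩, hSS' x hx (mem_ball.2 hy)⟩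
        have h1 : -1 < min (t + (1 / 2 : ℝ) ^ 2) 0 := lt_min (by linarith [ht.1]) (by norm_num)
        have h2 : z₀.1 = min (t + (1 / 2 : ℝ) ^ 2) 0 := rfl
        rw [h2] at hs1
        nlinarith
      exact ae_restrict_of_ae_restrict_of_subset hcyl hfar
    · rw [hPeq]
      exact lintegral_sub_ballMean_le_typeIBound (by norm_num) hz₀t w π H
  obtain ⟨K, U, hUw, hUc, hCD, hjc, hbdK⟩ := exists_smooth_representative_of_locally_bounded_gauge
    NSBoundedHigherRegularityBounds_holds hSo (by norm_num : (0 : ℝ) < 1 / 2) hloc 4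
  -- ## the equations on the far region and the regularity of the representative
  set Ω : Set (ℝ × (EuclideanSpace ℝ (Fin 3))) := Ioo (-1 : ℝ) 0 ×ˢ S with hΩ
  have hΩo : IsOpen Ω := isOpen_Ioo.prod hSo
  have hΩle : (⟨Ω, hΩo⟩ : Opens (ℝ × (EuclideanSpace ℝ (Fin 3)))) ≤ (slab (EuclideanSpace ℝ (Fin 3)) (Iio (0 : ℝ)) isOpen_Iio) := by
    intro z hz
    rw [mem_slab]
    exact hz.1.2
  have hsolw : IsDistributionalNSSolutionOn ⟨Ω, hΩo⟩ 1 0 w π := (hsw.of_le hΩle).distributional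
  have hsol : IsDistributionalNSSolutionOn ⟨Ω, hΩo⟩ 1 0 U π :=
    hsolw.congr_ae hUw.symm (ae_of_all _ fun _ => rfl)
  have hU4 : ∀ t ∈ Ioo (-1 : ℝ) 0, ContDiffOn ℝ 4 (U t) S := fun t ht x hx =>
    ((hCD (t, x) ⟨ht, hx⟩).of_le (by norm_cast)).contDiffWithinAt
  have hΦ : ∀ n ≤ 4, ContinuousOn (fun z : ℝ × (EuclideanSpace ℝ (Fin 3)) => iteratedFDeriv ℝ n (U z.1) z.2) Ω :=
    fun n _ => hjc n
  have hK : ∀ n ≤ 3, ∀ z ∈ Ω, ‖iteratedFDeriv ℝ n (U z.1) z.2‖ ≤ K := fun n hn z hz =>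
    hbdK n (by omega) z hz
  exact ⟨U, K, hUw, hUc, hsol, hU4, hΦ, hK⟩

/-! ### KIT part 3 — K2R: NO SINGULAR APEX WITH AN IRROTATIONAL HALF-SPACE SCAR (representative form)

The tree's `RellichScarNoMildScar.not_isBackwardSingularPoint_of_weakZeroScar` / `stub_halfspaceLiouville` with the
top hypothesis moved from the VELOCITY (weak vanishing of `w(s)` / velocity scar-faintness) to the VORTICITY of a
`C¹`-sliced continuous representative `Uc` of `w` on `]-1,0[ × {⟪x,e⟫ > 0}`: `curl Uc(s, ·) → 0` at the top locally
uniformly near every point of the half-space.  No zoom (the apex bound makes the far half-space calm directly):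
S3′ → transfer of the top-curl hypothesis from `Uc` to the smooth representative `Uf` (both continuous, a.e. equal on an
open set) → S2′ (kit part 1) → S4 (`stub_halfspaceStripLiouville`, tree) → the strips exhaust `]-1/3, 0[`. -/

set_option maxHeartbeats 800000 in
/-- **K2R — an apex Type-I profile whose vorticity fades at the top on an open half-space is not singular.**
Setting: `(w, π)` suitable weak on the backward slab with weak gradient `H`, `𝐈 < ⊤`, the apex bound
`‖w(t,x)‖ ≤ C/(‖x‖ + √(−t))` a.e.; `Uc` a continuous representative of `w` on `]-1,0[ × {⟪x,e⟫ > 0}` with `C¹`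
slices whose curl tends to zero at the top locally uniformly near every point of the half-space.  Then the origin
is not a backward singular point of `w`. [cite: EscauriazaSereginSverak2003, Thm. 1.4, §3 and Thm. 5.1] -/
theorem not_isBackwardSingularPoint_of_topCurlVanishing_halfspace
    {w : ℝ → (EuclideanSpace ℝ (Fin 3)) → (EuclideanSpace ℝ (Fin 3))} {π : ℝ → (EuclideanSpace ℝ (Fin 3)) → ℝ} {H : ℝ → (EuclideanSpace ℝ (Fin 3)) → (EuclideanSpace ℝ (Fin 3)) →L[ℝ] (EuclideanSpace ℝ (Fin 3))}
    (hsw : IsSuitableWeakSolutionOn (Literature.Analysis.FluidPDE.slab (EuclideanSpace ℝ (Fin 3)) (Set.Iio (0 : ℝ)) isOpen_Iio) 1 0 w π) (hwg : HasWeakSpatialGradientOn (Literature.Analysis.FluidPDE.slab (EuclideanSpace ℝ (Fin 3)) (Set.Iio (0 : ℝ)) isOpen_Iio) w H)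
    (hI : typeIBound (Iio (0 : ℝ) ×ˢ univ) w π H < ⊤) {C : ℝ}
    (hapex : ∀ᵐ z ∂(volume.restrict (Iio (0 : ℝ) ×ˢ (univ : Set (EuclideanSpace ℝ (Fin 3))))),
      ‖w z.1 z.2‖ ≤ C / (‖z.2‖ + Real.sqrt (-z.1)))
    {e : (EuclideanSpace ℝ (Fin 3))} (he : ‖e‖ = 1) {Uc : ℝ → (EuclideanSpace ℝ (Fin 3)) → (EuclideanSpace ℝ (Fin 3))}
    (hUc : uncurry Uc =ᵐ[volume.restrict (Ioo (-1 : ℝ) 0 ×ˢ {x : (EuclideanSpace ℝ (Fin 3)) | 0 < ⟪x, e⟫})] uncurry w)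
    (hUcc : ContinuousOn (uncurry Uc) (Ioo (-1 : ℝ) 0 ×ˢ {x : (EuclideanSpace ℝ (Fin 3)) | 0 < ⟪x, e⟫}))
    (htopc : ∀ x₁ : (EuclideanSpace ℝ (Fin 3)), 0 < ⟪x₁, e⟫ → ∀ θ : ℝ, 0 < θ → ∃ s₀ δ : ℝ, s₀ < 0 ∧ (-1 : ℝ) ≤ s₀ ∧ 0 < δ ∧
      ∀ s ∈ Ioo s₀ 0, ∀ x ∈ ball x₁ δ, ‖curl (Uc s) x‖ ≤ θ) :
    ¬ IsBackwardSingularPoint w 0 := by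
  intro hsing
  have hSo : ∀ R : ℝ, IsOpen {x : (EuclideanSpace ℝ (Fin 3)) | R < ⟪x, e⟫} := fun R =>
    isOpen_lt continuous_const (continuous_id.inner continuous_const)
  have hSm : ∀ R : ℝ, MeasurableSet {x : (EuclideanSpace ℝ (Fin 3)) | R < ⟪x, e⟫} := fun R => (hSo R).measurableSet
  have hinner : ∀ x : (EuclideanSpace ℝ (Fin 3)), ⟪x, e⟫ ≤ ‖x‖ := fun x => by
    have h := real_inner_le_norm x e
    rwa [he, mul_one] at h
  -- ## the far half-space `{⟪x, e⟫ > R₀}`: `|w| ≤ 1` by the apex bound (no zoom needed)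
  set R₀ : ℝ := max C 1 with hR₀def
  have hR₀ : 0 < R₀ := lt_of_lt_of_le one_pos (le_max_right _ _)
  have hfar : ∀ᵐ z ∂(volume.restrict (Ioo (-2 : ℝ) 0 ×ˢ {x : (EuclideanSpace ℝ (Fin 3)) | R₀ < ⟪x, e⟫})), ‖w z.1 z.2‖ ≤ 1 := by
    have hsub : Ioo (-2 : ℝ) 0 ×ˢ {x : (EuclideanSpace ℝ (Fin 3)) | R₀ < ⟪x, e⟫} ⊆ Iio (0 : ℝ) ×ˢ (univ : Set (EuclideanSpace ℝ (Fin 3))) :=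
      prod_mono Ioo_subset_Iio_self (subset_univ _)
    filter_upwards [ae_restrict_of_ae_restrict_of_subset hsub hapex,
      ae_restrict_mem (measurableSet_Ioo.prod (hSm R₀))] with z hz hzmem
    have hxe : R₀ < ⟪z.2, e⟫ := hzmem.2
    have hxn : R₀ < ‖z.2‖ := lt_of_lt_of_le hxe (hinner z.2)
    have ht : z.1 < 0 := hzmem.1.2
    have hs : 0 < Real.sqrt (-z.1) := Real.sqrt_pos.2 (by linarith)
    refine hz.trans ?_
    rcases le_or_gt C 0 with hC | hC
    · exact (div_nonpos_of_nonpos_of_nonneg hC (by positivity)).trans zero_le_one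
    · rw [div_le_one (by positivity)]
      have : C ≤ R₀ := le_max_left _ _
      linarith
  -- ## S3′: the far-field representative (no top input)
  obtain ⟨Uf, Kf, hUf, hUfc, hsol, hU4, hΦ, hKf⟩ :=
    halfspaceFarFieldRepresentative_noTop e he R₀ hR₀ w π H hsw hwg hI hfar
  -- ## `Uf = Uc` pointwise on the far region (both continuous, a.e. equal on an open set)
  set Sf : Set (EuclideanSpace ℝ (Fin 3)) := {x : (EuclideanSpace ℝ (Fin 3)) | R₀ + 1 < ⟪x, e⟫} with hSfdef
  set Ωf : Set (ℝ × (EuclideanSpace ℝ (Fin 3))) := Ioo (-1 : ℝ) 0 ×ˢ Sf with hΩfdef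
  have hΩfo : IsOpen Ωf := isOpen_Ioo.prod (hSo (R₀ + 1))
  have hΩsub : Ωf ⊆ Ioo (-1 : ℝ) 0 ×ˢ {x : (EuclideanSpace ℝ (Fin 3)) | 0 < ⟪x, e⟫} :=
    prod_mono Subset.rfl fun x (hx : R₀ + 1 < ⟪x, e⟫) => show 0 < ⟪x, e⟫ by linarith
  have hUcf : uncurry Uc =ᵐ[volume.restrict Ωf] uncurry w :=
    ae_restrict_of_ae_restrict_of_subset hΩsub hUc
  have haefc : uncurry Uf =ᵐ[volume.restrict Ωf] uncurry Uc := hUf.trans hUcf.symm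
  have hEq : EqOn (uncurry Uf) (uncurry Uc) Ωf :=
    Measure.eqOn_open_of_ae_eq haefc hΩfo hUfc (hUcc.mono hΩsub)
  have hcurl_eq : ∀ s ∈ Ioo (-1 : ℝ) 0, ∀ x ∈ Sf, curl (Uf s) x = curl (Uc s) x := by
    intro s hs x hx
    have hev : Uf s =ᶠ[𝓝 x] Uc s := by
      filter_upwards [(hSo (R₀ + 1)).mem_nhds hx] with x' hx'
      exact hEq (show (s, x') ∈ Ωf from ⟨hs, hx'⟩)
    have hfd : fderiv ℝ (Uf s) x = fderiv ℝ (Uc s) x := hev.fderiv_eq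
    simp only [curl, hfd]
  -- ## the top-curl hypothesis transported to `Uf`
  have htopf : ∀ x₁ ∈ Sf, ∀ θ : ℝ, 0 < θ → ∃ s₀ δ : ℝ, s₀ < 0 ∧ (-1 : ℝ) ≤ s₀ ∧ 0 < δ ∧
      ∀ s ∈ Ioo s₀ 0, ∀ x ∈ ball x₁ δ, ‖curl (Uf s) x‖ ≤ θ := by
    intro x₁ hx₁ θ hθ
    have hx₁pos : 0 < ⟪x₁, e⟫ := by
      have h : R₀ + 1 < ⟪x₁, e⟫ := hx₁
      linarith
    obtain ⟨s₀, δ, hs₀, hs₀1, hδ, hsm⟩ := htopc x₁ hx₁pos θ hθ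
    obtain ⟨δ', hδ', hball⟩ := Metric.isOpen_iff.1 (hSo (R₀ + 1)) x₁ hx₁
    refine ⟨s₀, min δ δ', hs₀, hs₀1, lt_min hδ hδ', fun s hs x hx => ?_⟩
    have hxδ : x ∈ ball x₁ δ := ball_subset_ball (min_le_left _ _) hx
    have hxS : x ∈ Sf := hball (ball_subset_ball (min_le_right _ _) hx)
    have hs' : s ∈ Ioo (-1 : ℝ) 0 := ⟨lt_of_le_of_lt hs₀1 hs.1, hs.2⟩
    rw [hcurl_eq s hs' x hxS]
    exact hsm s hs x hxδ
  -- ## S2′: the far-field vorticity vanishes beyond the half-space `x₀ + {⟪y, e⟫ > 0}`, `x₀ = (R₀ + 2) e`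
  set x₀ : (EuclideanSpace ℝ (Fin 3)) := (R₀ + 2) • e with hx₀def
  have hx₀e : ⟪x₀, e⟫ = R₀ + 2 := by
    rw [hx₀def, real_inner_smul_left, real_inner_self_eq_norm_sq, he]; ring
  have hx₀S : ∀ y : (EuclideanSpace ℝ (Fin 3)), 0 < ⟪y, e⟫ → x₀ + y ∈ Sf := by
    intro y hy
    show R₀ + 1 < ⟪x₀ + y, e⟫
    rw [inner_add_left, hx₀e]
    linarith
  have hcurl0 := halfspaceFarFieldCurl_of_topCurlVanishing Sf (hSo (R₀ + 1)) x₀ e he hx₀S Uf π Kf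
    htopf hsol hU4 hΦ hKf
  have hcurl : ∀ z ∈ Ioo (-1 : ℝ) 0 ×ˢ {x : (EuclideanSpace ℝ (Fin 3)) | R₀ + 1 + 1 < ⟪x, e⟫}, curl (Uf z.1) z.2 = 0 := by
    rintro z ⟨hz1, hz2⟩
    refine hcurl0 z ⟨hz1, ?_⟩
    show ⟪x₀, e⟫ < ⟪z.2, e⟫
    have hz2' : R₀ + 1 + 1 < ⟪z.2, e⟫ := hz2
    rw [hx₀e]
    linarith
  -- ## S4 on the strips `]-1/3, -1/(n+4)[`, the apex bound bounding the velocity there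
  have hstrip : ∀ n : ℕ, ∀ᵐ s ∂(volume.restrict (Ioo (-(1 / 3 : ℝ)) (-(1 / ((n : ℝ) + 4))))),
      w s =ᵐ[volume] 0 := by
    intro n
    set b : ℝ := -(1 / ((n : ℝ) + 4)) with hbdef
    have hb : b < 0 := by rw [hbdef, neg_lt_zero]; positivity
    have hbd : ∀ᵐ z ∂(volume.restrict (Ioo (-(1 / 3 : ℝ) - 4 * (1 / 4 : ℝ) ^ 2) b ×ˢ (univ : Set (EuclideanSpace ℝ (Fin 3))))),
        ‖w z.1 z.2‖ ≤ max C 0 / Real.sqrt (-b) := by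
      have hsub : Ioo (-(1 / 3 : ℝ) - 4 * (1 / 4 : ℝ) ^ 2) b ×ˢ (univ : Set (EuclideanSpace ℝ (Fin 3))) ⊆
          Iio (0 : ℝ) ×ˢ (univ : Set (EuclideanSpace ℝ (Fin 3))) := prod_mono (fun t ht => ht.2.trans hb) Subset.rfl
      filter_upwards [ae_restrict_of_ae_restrict_of_subset hsub hapex,
        ae_restrict_mem (measurableSet_Ioo.prod MeasurableSet.univ)] with z hz hzmem
      have ht : z.1 < b := hzmem.1.2
      have hs : 0 < Real.sqrt (-z.1) := Real.sqrt_pos.2 (by linarith)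
      have hsb : 0 < Real.sqrt (-b) := Real.sqrt_pos.2 (by linarith)
      calc ‖w z.1 z.2‖ ≤ C / (‖z.2‖ + Real.sqrt (-z.1)) := hz
        _ ≤ max C 0 / (‖z.2‖ + Real.sqrt (-z.1)) :=
            div_le_div_of_nonneg_right (le_max_left _ _) (by positivity)
        _ ≤ max C 0 / Real.sqrt (-z.1) :=
            div_le_div_of_nonneg_left (le_max_right _ _) hs (le_add_of_nonneg_left (norm_nonneg _))
        _ ≤ max C 0 / Real.sqrt (-b) :=
            div_le_div_of_nonneg_left (le_max_right _ _) hsb (Real.sqrt_le_sqrt (by linarith))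
    exact stub_halfspaceStripLiouville e he (R₀ + 1) (by positivity) w π H Uf hsw hwg hI hUf hUfc
      hcurl (-(1 / 3 : ℝ)) b (1 / 4) (max C 0 / Real.sqrt (-b)) (by norm_num) (by norm_num) hb.le hbd
  -- ## `w(s) = 0` a.e. for a.e. `s ∈ ]-1/3, 0[`
  have hae0 : ∀ᵐ s ∂(volume.restrict (Ioo (-(1 / 3 : ℝ)) 0)), w s =ᵐ[volume] 0 := by
    have hcov : Ioo (-(1 / 3 : ℝ)) 0 ⊆ ⋃ n : ℕ, Ioo (-(1 / 3 : ℝ)) (-(1 / ((n : ℝ) + 4))) := by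
      intro s hs
      obtain ⟨n, hn⟩ := exists_nat_one_div_lt (neg_pos.2 hs.2)
      refine mem_iUnion.2 ⟨n, hs.1, ?_⟩
      have h1 : 1 / ((n : ℝ) + 4) ≤ 1 / ((n : ℝ) + 1) :=
        one_div_le_one_div_of_le (by positivity) (by linarith)
      linarith
    refine ae_restrict_of_ae_restrict_of_subset hcov ?_
    rw [ae_restrict_iUnion_iff]
    exact hstrip
  -- ## `w = 0` a.e. on `Q(0, 1/2)`: the origin is not singular
  have hQ : parabolicCylinder (1 / 2) (0 : ℝ × (EuclideanSpace ℝ (Fin 3))) = Ioo (-(1 / 4 : ℝ)) 0 ×ˢ ball (0 : (EuclideanSpace ℝ (Fin 3))) (1 / 2) := by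
    rw [parabolicCylinder]
    simp only [Prod.fst_zero, Prod.snd_zero, zero_sub]
    norm_num
  have hwmQ : AEStronglyMeasurable (uncurry w)
      (volume.restrict (parabolicCylinder (1 / 2) (0 : ℝ × (EuclideanSpace ℝ (Fin 3))))) :=
    hwg.locallyIntegrableOn.aestronglyMeasurable.mono_measure
      (Measure.restrict_mono (parabolicCylinder_subset_slab _ le_rfl) le_rfl)
  have hzero : ∫⁻ z in parabolicCylinder (1 / 2) (0 : ℝ × (EuclideanSpace ℝ (Fin 3))), ‖w z.1 z.2‖ₑ = 0 := by
    have hf : AEMeasurable (fun z : ℝ × (EuclideanSpace ℝ (Fin 3)) => ‖w z.1 z.2‖ₑ)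
        ((volume.restrict (Ioo (-(1 / 4 : ℝ)) 0)).prod (volume.restrict (ball (0 : (EuclideanSpace ℝ (Fin 3))) (1 / 2)))) := by
      rw [Measure.prod_restrict, ← Measure.volume_eq_prod, ← hQ]
      exact hwmQ.enorm
    rw [hQ, Measure.volume_eq_prod, ← Measure.prod_restrict, lintegral_prod _ hf]
    refine (lintegral_congr_ae ?_).trans lintegral_zero
    filter_upwards [ae_restrict_of_ae_restrict_of_subset (Ioo_subset_Ioo (by norm_num) le_rfl) hae0] with t ht
    refine (lintegral_congr_ae ?_).trans lintegral_zero
    filter_upwards [ae_restrict_of_ae ht] with x hx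
    simp [hx]
  have hae : ∀ᵐ z ∂(volume.restrict (parabolicCylinder (1 / 2) (0 : ℝ × (EuclideanSpace ℝ (Fin 3))))),
      uncurry w z = (0 : ℝ × (EuclideanSpace ℝ (Fin 3)) → (EuclideanSpace ℝ (Fin 3))) z := by
    have h := (lintegral_eq_zero_iff' hwmQ.enorm).1 hzero
    filter_upwards [h] with ⟨t, x⟩ hz
    have hz' : ‖w t x‖ₑ = 0 := hz
    simpa using hz'
  have h0 : eLpNorm (uncurry w) ⊤ (volume.restrict (parabolicCylinder (1 / 2) (0 : ℝ × (EuclideanSpace ℝ (Fin 3))))) = 0 :=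
    (eLpNorm_eq_zero_iff hwmQ ENNReal.top_ne_zero).2 hae
  have h := hsing (1 / 2) (by norm_num)
  rw [h0] at h
  exact ENNReal.zero_ne_top h

end Summit.NavierStokesRegularity.NavierStokesRegularity.Theorems.RellichScarApexLocalisationIrrotHalfspaceLiouville

end
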